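import Mathlib
import Summits.Ventures.PercRepro2.KPrimeReduction
import Summits.Ventures.PercRepro2.KPrimeSure
import Summits.Ventures.PercRepro2.KPrimeEdgeSteps
import Summits.Ventures.PercRepro2.KPrimePendantLemmas
import Summits.Ventures.PercRepro2.AvoidMono
import Summits.Ventures.PercRepro2.KPrimePendantB
import Summits.Ventures.PercRepro2.KPrimeLeakPendant
import Summits.Ventures.PercRepro2.KPrimeLeakLinear

/-!
# The `u`-piece of the GLUE form is a theorem: the odds of `a₁ ↔ v` inside `Ω` do not fall
when `a₁`'s root grows by `z`
(blind cell PercRepro2, mine-c g37; `conjectures/MINE-C.md` §46.8 (i))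

The glue form of `KPrimeLeakLinear.lean` splits as `Glue = YS·(H_/·D₀ − H·D₀_/) + Sm·(O1_/·D₀ −
O1·D₀_/) − Sm·(D_/·D₀ − D·D₀_/)` (base masses of `p[e₂ ↦ 0]`, glued masses of `p[e₂ ↦ 1][e₁ ↦ 1]`).
Its first piece is g30's avoided-set monotonicity (Z-MONO) = `AvoidMono.avoid_mono`: along the
family `p[e₂ ↦ 1][e₁ ↦ r]` the edge `e₁ = {b, a₁}` sits at `a₁`, the avoided vertex of `a₂`'s
avoidance `{a₂ ↮ a₁} = Ω`, so `P_r(a₁ ↔ v | Ω)` is non-decreasing in `r`; with `Ω = (U ∩ Ω) ⊔ N`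
this is `H_/·D₀ ≥ H·D₀_/` (`glue_piece_u`), the termwise half `H_/·D₀ ≥ H·D₀_/` of
`MINE-C.md` §46.3 / §46.8 (0 / 377 + 0 / 2,600 in census, now a theorem).
-/

namespace Summit.Ventures.PercRepro2

namespace KPrime

variable {V : Type*} {E : Type*} [Fintype E] [DecidableEq E] [Fintype V] [DecidableEq V]
  {R : Type*} [Field R] [LinearOrder R] [IsStrictOrderedRing R]

section GlueU

variable {ends : E → Sym2 V} {a₁ a₂ b v y z : V} {e₁ e₂ : E} {p : E → R}

omit [Fintype E] [DecidableEq E] [Fintype V] [DecidableEq V] [Field R] [LinearOrder R]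
  [IsStrictOrderedRing R] in
/-- `{a₂ ↮ a₁}` is `Ω = {a₁ ↮ a₂}`. -/
lemma avoidAll_a₂_a₁_eq_Ω : avoidAll ends a₂ {a₁} = Ω ends a₁ a₂ := by
  ext ω
  simp only [avoidAll, Ω, Set.mem_setOf_eq, Finset.mem_singleton, forall_eq]
  exact ⟨fun h hc => h (conn_symm hc), fun h hc => h (conn_symm hc)⟩

omit [Fintype E] [DecidableEq E] [Fintype V] [Field R] [LinearOrder R]
  [IsStrictOrderedRing R] in
/-- `Ω ∖ U = N`: inside `Ω`, `a₁ ↮ v` is `N`. -/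
lemma Ω_inter_compl_eq_N : Ω ends a₁ a₂ ∩ (connEvent ends a₁ v)ᶜ = N ends a₁ a₂ v := by
  ext ω
  simp only [Set.mem_inter_iff, Set.mem_compl_iff, mem_connEvent, Ω, N, avoidAll,
    Set.mem_setOf_eq, Finset.mem_singleton, Finset.mem_insert, forall_eq_or_imp, forall_eq]

omit [Fintype V] [LinearOrder R] [IsStrictOrderedRing R] in
/-- `P(Ω) = P(U ∩ Ω) + P(N)`. -/
lemma prob_Ω_split (p : E → R) :
    prob p (Ω ends a₁ a₂) = prob p (connEvent ends a₁ v ∩ Ω ends a₁ a₂) + prob p (N ends a₁ a₂ v) := by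
  have h := prob_inter_add_prob_inter_compl p (Ω ends a₁ a₂) (connEvent ends a₁ v)
  rw [← h, Set.inter_comm, Ω_inter_compl_eq_N]

/-- **The `u`-piece of the glue is a theorem (Z-MONO at the root)**: with `b` attached to `a₁` by
`e₁` and to `z` by `e₂` (and to nothing else), the odds of `a₁ ↔ v` inside `Ω` do not fall when
the bridge closes `a₁` and `z` together:
`P⁰(U ∩ Ω) · P¹¹(N) ≤ P¹¹(U ∩ Ω) · P⁰(N)` (`P⁰ = p[e₂ ↦ 0]`, `P¹¹ = p[e₂ ↦ 1][e₁ ↦ 1]`). -/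
theorem glue_piece_u (hp : IsProbVec p) (hb : ∀ f, b ∈ ends f → f = e₁ ∨ f = e₂)
    (h₁ : ends e₁ = s(b, a₁)) (h₂ : ends e₂ = s(b, z)) (hne : e₁ ≠ e₂)
    (hba₁ : b ≠ a₁) (hba₂ : b ≠ a₂) (hbv : b ≠ v) :
    prob (Function.update p e₂ 0) (connEvent ends a₁ v ∩ Ω ends a₁ a₂) *
        prob (Function.update (Function.update p e₂ 1) e₁ 1) (N ends a₁ a₂ v) ≤
      prob (Function.update (Function.update p e₂ 1) e₁ 1) (connEvent ends a₁ v ∩ Ω ends a₁ a₂) *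
        prob (Function.update p e₂ 0) (N ends a₁ a₂ v) := by
  -- the base masses are those of the pendant-at-`z` world `p[e₂ ↦ 1][e₁ ↦ 0]`
  have hb' : ∀ f, b ∈ ends f → f = e₂ ∨ f = e₁ := fun f h => (hb f h).symm
  have hΩ₁ : PendInv e₁ e₂ (Ω ends a₁ a₂) :=
    pendInv_avoidAll hb h₁ hne (Ne.symm hba₁) (fun x hx => by
      rw [Finset.mem_singleton] at hx; rw [hx]; exact Ne.symm hba₂)
  have hΩ₂ : PendInv e₂ e₁ (Ω ends a₁ a₂) :=
    pendInv_avoidAll hb' h₂ hne.symm (Ne.symm hba₁) (fun x hx => by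
      rw [Finset.mem_singleton] at hx; rw [hx]; exact Ne.symm hba₂)
  have hU₁ : PendInv e₁ e₂ (connEvent ends a₁ v ∩ Ω ends a₁ a₂) :=
    (pendInv_connEvent hb h₁ hne (Ne.symm hba₁) (Ne.symm hbv)).inter hΩ₁
  have hU₂ : PendInv e₂ e₁ (connEvent ends a₁ v ∩ Ω ends a₁ a₂) :=
    (pendInv_connEvent hb' h₂ hne.symm (Ne.symm hba₁) (Ne.symm hbv)).inter hΩ₂
  have hNX : ∀ x ∈ ({a₂, v} : Finset V), x ≠ b := fun x hx => by
    simp only [Finset.mem_insert, Finset.mem_singleton] at hx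
    rcases hx with rfl | rfl
    · exact Ne.symm hba₂
    · exact Ne.symm hbv
  have hN₁ : PendInv e₁ e₂ (N ends a₁ a₂ v) := pendInv_avoidAll hb h₁ hne (Ne.symm hba₁) hNX
  have hN₂ : PendInv e₂ e₁ (N ends a₁ a₂ v) := pendInv_avoidAll hb' h₂ hne.symm (Ne.symm hba₁) hNX
  rw [← prob_pendantZ_eq_leakClosed hne hU₁ hU₂, ← prob_pendantZ_eq_leakClosed hne hN₁ hN₂]
  -- now everything lives in the family `p' = p[e₂ ↦ 1]` with `e₁` at weight `0` and `1`
  set p' := Function.update p e₂ 1 with hp'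
  have hp'v : IsProbVec p' := hp.update e₂ zero_le_one le_rfl
  have hends : ends e₁ = s(a₁, b) := by rw [h₁, Sym2.eq_swap]
  have h𝓥 : IsUpperSet {K : Set V | v ∈ K} := fun _ _ hST h => hST h
  have hsplit0 := prob_Ω_split (ends := ends) (a₁ := a₁) (a₂ := a₂) (v := v)
    (Function.update p' e₁ 0)
  have hsplit1 := prob_Ω_split (ends := ends) (a₁ := a₁) (a₂ := a₂) (v := v)
    (Function.update p' e₁ 1)
  have hp0 : IsProbVec (Function.update p' e₁ 0) := hp'v.update e₁ le_rfl zero_le_one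
  have hp1 : IsProbVec (Function.update p' e₁ 1) := hp'v.update e₁ zero_le_one le_rfl
  have hH0 := prob_nonneg hp0 (connEvent ends a₁ v ∩ Ω ends a₁ a₂)
  have hH1 := prob_nonneg hp1 (connEvent ends a₁ v ∩ Ω ends a₁ a₂)
  have hD0 := prob_nonneg hp0 (N ends a₁ a₂ v)
  have hD1 := prob_nonneg hp1 (N ends a₁ a₂ v)
  -- degenerate worlds
  by_cases hΩ0 : prob (Function.update p' e₁ 0) (Ω ends a₁ a₂) = 0
  · have h1 : prob (Function.update p' e₁ 0) (connEvent ends a₁ v ∩ Ω ends a₁ a₂) = 0 := by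
      linarith
    have h2 : prob (Function.update p' e₁ 0) (N ends a₁ a₂ v) = 0 := by linarith
    rw [h1, h2]; simp
  by_cases hΩ1 : prob (Function.update p' e₁ 1) (Ω ends a₁ a₂) = 0
  · have h1 : prob (Function.update p' e₁ 1) (connEvent ends a₁ v ∩ Ω ends a₁ a₂) = 0 := by
      linarith
    have h2 : prob (Function.update p' e₁ 1) (N ends a₁ a₂ v) = 0 := by linarith
    rw [h1, h2]; simp
  have hpos0 : 0 < prob (Function.update p' e₁ 0) (avoidAll ends a₂ {a₁}) := by
    rw [avoidAll_a₂_a₁_eq_Ω]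
    exact lt_of_le_of_ne (prob_nonneg hp0 _) (Ne.symm hΩ0)
  have hpos1 : 0 < prob (Function.update p' e₁ 1) (avoidAll ends a₂ {a₁}) := by
    rw [avoidAll_a₂_a₁_eq_Ω]
    exact lt_of_le_of_ne (prob_nonneg hp1 _) (Ne.symm hΩ1)
  -- (Z-MONO) at the avoided vertex `a₁` of `a₂`'s avoidance `{a₁}`, up-set `{K | v ∈ K}`
  have hmono := AvoidMono.avoid_mono p' ends hp'v hends a₁ a₂ (S := {a₁})
    (Finset.mem_singleton_self a₁) (Finset.mem_singleton_self a₁) h𝓥 zero_le_one hpos0 hpos1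
  rw [AvoidMono.clusterInEvent_single, avoidAll_a₂_a₁_eq_Ω] at hmono
  rw [avoidAll_a₂_a₁_eq_Ω] at hpos0 hpos1
  rw [div_le_div_iff₀ hpos0 hpos1] at hmono
  -- `H₀·Ω₁ ≤ H₁·Ω₀` with `Ω = H + D₀` gives `H₀·D₀₁ ≤ H₁·D₀₀`
  rw [hsplit0, hsplit1] at hmono
  nlinarith [hmono, hH0, hH1, hD0, hD1]

end GlueU

end KPrime

end Summit.Ventures.PercRepro2
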